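import Summits.SmoothPoincare4.SmoothPoincare4.Theorems.SullivanDualTargetOfSympcap
import Literature.Geometry.Symplectic.GromovR4StdModel
import Summits.SmoothPoincare4.SmoothPoincare4.Theorems.SullivanDualTargetHelperSlowStep
import Summits.SmoothPoincare4.SmoothPoincare4.Theorems.SullivanDualTargetHelperCollarInterpolation
import Mathlib.Analysis.Calculus.MeanValue
import Mathlib.Analysis.InnerProductSpace.Calculus

/-!
# SmoothPoincare4 / SullivanDual — crux `Target` (stmt-SmoothPoincare4-7823), line `kaehler-jacket`:
# helper `helper_linearizeImmersion2` (wave 2)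

**Linearise-and-rotate a local diffeomorphism germ.**  Let `f : ℝ⁴ → ℝ⁴` be a smooth immersion
of the ball `‖y‖ < r₄` with `f 0 = 0` and `df(0) = L`, and let `A` be a linear isometry such that
the whole segment `T_t = (1 - t)·id + t·(A ∘ L)`, `t ∈ [0, 1]`, consists of injective maps.  We
produce a map `g`, smooth with injective differential on the ball `‖y‖ < r₄`, equal to the
isometry `A⁻¹` on a small ball `‖y‖ ≤ r₁` and to `f` on `r₃ ≤ ‖y‖` (`0 < r₁ < r₃ < r₄`).

Construction.  With `S_t = A⁻¹ ∘ T_t = (1 - t)·A⁻¹ + t·L` (injective for `t ∈ [0, 1]`, hence,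
by compactness of `[0, 1] × 𝕊³`, uniformly bounded below: `‖S_t v‖ ≥ m ‖v‖`) and two radial
log-slow cut-offs `χ₁` (outer: `0` below `r₂`, `1` above `r₃`, `|r χ₁'| ≤ 1`) and `χ₂` (inner:
`0` below `r₁`, `1` above `r₂`, `|r χ₂'| ≤ η₂`) from `helper_slowStep`, put
`g y = (1 - χ₂ ‖y‖) • A⁻¹ y + χ₂ ‖y‖ • L y + χ₁ ‖y‖ • (f y - L y)`.
On `‖y‖ ≤ r₁` both cut-offs vanish (`g = A⁻¹`), on `r₃ ≤ ‖y‖` both are `1` (`g = f`).  In between,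
`dg(y) v = S_{χ₂(r)} v + χ₂'(r) (⟪y, v⟫ / r) • (L y - A⁻¹ y) + χ₁(r) • (df(y) v - L v)
  + χ₁'(r) (⟪y, v⟫ / r) • (f y - L y)`, `r = ‖y‖`,
and the three error terms are at most `η₂ ‖L - A⁻¹‖ ‖v‖`, `ε ‖v‖`, `ε ‖v‖` where
`‖df - L‖ ≤ ε` and `‖f y - L y‖ ≤ ε ‖y‖` on the ball `‖y‖ ≤ r₃` (continuity of `df` at `0`
and the mean value inequality); choosing `ε = m / 8` and `η₂ ‖L - A⁻¹‖ ≤ m / 4` the error cannot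
cancel the main term, so `dg(y)` is injective.  Elementary multivariable calculus on top of
Mathlib; the only project facts used are the landed helpers `helper_slowStep` (log-slow step) and
`collarInterp_hasFDerivAt_norm` (derivative of the Euclidean norm). [folklore]

References: M. W. Hirsch, *Differential Topology*, GTM 33 (1976), Ch. 8 §1 (linearisation of
embeddings of discs); J. Milnor, *Topology from the differentiable viewpoint* (1965), §6.
-/

noncomputable section

set_option linter.dupNamespace false

open scoped Manifold ContDiff Topology
open Set Function
open Literature.Geometry.Kaehler (MForm IsSmoothForm IsClosedForm mextDeriv)
open Literature.Geometry.Symplectic (punctured InPuncturedChartBall stdSymplecticForm inversion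
  invertedStdForm IsSymplecticStandardNearPoint AgreesWithInvertedChartNear)
open Literature.Topology.FourManifolds (HomotopySphere)

namespace Summit.SmoothPoincare4.SmoothPoincare4.Theorems.Target.KaehlerJacket

local notation "E4" => EuclideanSpace ℝ (Fin 4)

/-- **Uniform lower bound along a compact segment of injective maps.** If every map
`S_t = (1 - t)·A' + t·L`, `t ∈ [0, 1]`, of `ℝ⁴` has trivial kernel, then there is `m > 0` with
`m ‖v‖ ≤ ‖S_t v‖` for all `t ∈ [0, 1]` and all `v` (minimise the continuous positive function
`(t, v) ↦ ‖S_t v‖` over the compact set `[0, 1] × 𝕊³`). [folklore] -/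
theorem linImm_uniform_lower_bound (A' L : E4 →L[ℝ] E4)
    (hinj : ∀ t : ℝ, 0 ≤ t → t ≤ 1 → ∀ v : E4, (1 - t) • A' v + t • L v = 0 → v = 0) :
    ∃ m : ℝ, 0 < m ∧
      ∀ t : ℝ, 0 ≤ t → t ≤ 1 → ∀ v : E4, m * ‖v‖ ≤ ‖(1 - t) • A' v + t • L v‖ := by
  obtain ⟨φ, hφ⟩ : ∃ φ : ℝ × E4 → ℝ, φ = fun p => ‖(1 - p.1) • A' p.2 + p.1 • L p.2‖ :=
    ⟨_, rfl⟩
  have hφc : Continuous φ := by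
    rw [hφ]
    fun_prop
  set K : Set (ℝ × E4) := Icc (0 : ℝ) 1 ×ˢ Metric.sphere (0 : E4) 1
  have hKc : IsCompact K := isCompact_Icc.prod (isCompact_sphere 0 1)
  obtain ⟨u₀, hu₀⟩ : ∃ u : E4, ‖u‖ = 1 :=
    ⟨EuclideanSpace.single 0 1, by simp⟩
  have hKne : K.Nonempty :=
    ⟨(0, u₀), ⟨le_rfl, zero_le_one⟩, mem_sphere_zero_iff_norm.mpr hu₀⟩
  obtain ⟨p, hpK, hpmin⟩ := hKc.exists_isMinOn hKne hφc.continuousOn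
  obtain ⟨⟨hp0, hp1⟩, hpS⟩ := hpK
  have hp2 : ‖p.2‖ = 1 := mem_sphere_zero_iff_norm.mp hpS
  have hpos : 0 < φ p := by
    rw [hφ]
    refine norm_pos_iff.mpr fun h0 => ?_
    have h := hinj p.1 hp0 hp1 p.2 h0
    rw [h, norm_zero] at hp2
    exact zero_ne_one hp2
  refine ⟨φ p, hpos, fun t ht0 ht1 v => ?_⟩
  by_cases hv : v = 0
  · simp [hv]
  have hv0 : 0 < ‖v‖ := norm_pos_iff.mpr hv
  set u : E4 := ‖v‖⁻¹ • v with hu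
  have hu1 : ‖u‖ = 1 := by
    rw [hu, norm_smul, norm_inv, norm_norm, inv_mul_cancel₀ hv0.ne']
  have hmem : (t, u) ∈ K := ⟨⟨ht0, ht1⟩, mem_sphere_zero_iff_norm.mpr hu1⟩
  have hle : φ p ≤ φ (t, u) := isMinOn_iff.mp hpmin _ hmem
  have hφu : φ (t, u) = ‖v‖⁻¹ * ‖(1 - t) • A' v + t • L v‖ := by
    have h1 : (1 - t) • A' u + t • L u = ‖v‖⁻¹ • ((1 - t) • A' v + t • L v) := by
      rw [hu, map_smul, map_smul, smul_add, smul_comm (1 - t), smul_comm t]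
    rw [hφ]
    show ‖(1 - t) • A' u + t • L u‖ = _
    rw [h1, norm_smul, norm_inv, norm_norm]
  rw [hφu] at hle
  calc φ p * ‖v‖ ≤ ‖v‖⁻¹ * ‖(1 - t) • A' v + t • L v‖ * ‖v‖ := by gcongr
    _ = ‖(1 - t) • A' v + t • L v‖ := by field_simp

/-- **Kernel triviality from a dominated error.** If `m ‖v‖ ≤ ‖S v‖` and
`S v + e₁ + e₂ + e₃ = 0` with `‖e₁‖ ≤ (m/4) ‖v‖`, `‖e₂‖, ‖e₃‖ ≤ (m/8) ‖v‖`, then `v = 0`.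
[folklore] -/
theorem linImm_eq_zero_of_sum_eq_zero {v Sv e₁ e₂ e₃ : E4} {m : ℝ} (hm : 0 < m)
    (hS : m * ‖v‖ ≤ ‖Sv‖) (h₁ : ‖e₁‖ ≤ m / 4 * ‖v‖) (h₂ : ‖e₂‖ ≤ m / 8 * ‖v‖)
    (h₃ : ‖e₃‖ ≤ m / 8 * ‖v‖) (hsum : Sv + e₁ + e₂ + e₃ = 0) : v = 0 := by
  have hSv : Sv = -(e₁ + e₂ + e₃) := by
    rw [eq_neg_iff_add_eq_zero, ← hsum]
    abel
  have hle : ‖Sv‖ ≤ m / 2 * ‖v‖ := by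
    rw [hSv, norm_neg]
    calc ‖e₁ + e₂ + e₃‖ ≤ ‖e₁‖ + ‖e₂‖ + ‖e₃‖ := norm_add₃_le
      _ ≤ m / 4 * ‖v‖ + m / 8 * ‖v‖ + m / 8 * ‖v‖ := by gcongr
      _ = m / 2 * ‖v‖ := by ring
  have hv : ‖v‖ ≤ 0 := by nlinarith [norm_nonneg v, hS.trans hle]
  exact norm_le_zero_iff.mp hv

/-- **Injectivity of the differential on the transition zone.** The explicit differential of
`g y = (1 - χ₂ ‖y‖) • A' y + χ₂ ‖y‖ • L y + χ₁ ‖y‖ • (f y - L y)` at `y ≠ 0` (values `c₁, c₂`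
and derivatives `a₁, a₂` of the cut-offs at `r = ‖y‖`, `K = df(y)`, `fy = f y`) has trivial
kernel as soon as `‖S_{c₂} v‖ ≥ m ‖v‖`, `‖L y - A' y‖ ≤ W ‖y‖`, `‖K - L‖ ≤ ε`,
`‖f y - L y‖ ≤ ε ‖y‖`, `c₁ ∈ [0, 1]`, `|r a₁| ≤ 1`, `|r a₂| ≤ η`, `η W ≤ m / 4` and `ε ≤ m / 8`.
[folklore] -/
theorem linImm_injective_fderiv {y fy : E4} {K L A' : E4 →L[ℝ] E4}
    {c₁ c₂ a₁ a₂ m η W ε : ℝ} (hy : y ≠ 0) (hm : 0 < m)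
    (hS : ∀ v : E4, m * ‖v‖ ≤ ‖(1 - c₂) • A' v + c₂ • L v‖)
    (hW : ‖L y - A' y‖ ≤ W * ‖y‖) (hK : ‖K - L‖ ≤ ε) (hfy : ‖fy - L y‖ ≤ ε * ‖y‖)
    (hc₁ : 0 ≤ c₁) (hc₁1 : c₁ ≤ 1) (ha₁ : |‖y‖ * a₁| ≤ 1) (ha₂ : |‖y‖ * a₂| ≤ η)
    (hηW : η * W ≤ m / 4) (hεm : ε ≤ m / 8) :
    Injective
      (((1 - c₂) • A' + (-(a₂ • (‖y‖⁻¹ • innerSL ℝ y))).smulRight (A' y)) +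
        (c₂ • L + (a₂ • (‖y‖⁻¹ • innerSL ℝ y)).smulRight (L y)) +
        (c₁ • (K - L) + (a₁ • (‖y‖⁻¹ • innerSL ℝ y)).smulRight (fy - L y))) := by
  have hr0 : 0 < ‖y‖ := norm_pos_iff.mpr hy
  have hε : 0 ≤ ε := le_trans (norm_nonneg _) hK
  have hW0 : 0 ≤ W * ‖y‖ := le_trans (norm_nonneg _) hW
  have hW0' : 0 ≤ W := nonneg_of_mul_nonneg_left hW0 hr0
  refine (injective_iff_map_eq_zero _).2 fun v hv => ?_
  simp only [add_apply, smul_apply, sub_apply, ContinuousLinearMap.smulRight_apply, neg_apply,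
    innerSL_apply_apply, smul_eq_mul] at hv
  set c : ℝ := ‖y‖⁻¹ * inner ℝ y v with hc_def
  have hc : |c| ≤ ‖v‖ := by
    rw [hc_def, abs_mul, abs_inv, abs_norm]
    calc ‖y‖⁻¹ * |inner ℝ y v| ≤ ‖y‖⁻¹ * (‖y‖ * ‖v‖) := by
          gcongr
          exact abs_real_inner_le_norm y v
      _ = ‖v‖ := by field_simp
  have he₁ : ‖(a₂ * c) • (L y - A' y)‖ ≤ m / 4 * ‖v‖ := by
    rw [norm_smul, Real.norm_eq_abs, abs_mul]
    calc |a₂| * |c| * ‖L y - A' y‖ ≤ |a₂| * ‖v‖ * (W * ‖y‖) := by gcongr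
      _ = |‖y‖ * a₂| * W * ‖v‖ := by rw [abs_mul, abs_norm]; ring
      _ ≤ η * W * ‖v‖ := by gcongr
      _ ≤ m / 4 * ‖v‖ := by gcongr
  have he₂ : ‖c₁ • (K v - L v)‖ ≤ m / 8 * ‖v‖ := by
    rw [norm_smul, Real.norm_eq_abs, abs_of_nonneg hc₁, ← sub_apply]
    have hKv : ‖(K - L) v‖ ≤ ε * ‖v‖ :=
      (ContinuousLinearMap.le_opNorm _ _).trans (mul_le_mul_of_nonneg_right hK (norm_nonneg v))
    calc c₁ * ‖(K - L) v‖ ≤ 1 * (ε * ‖v‖) := by gcongr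
      _ ≤ m / 8 * ‖v‖ := by rw [one_mul]; gcongr
  have he₃ : ‖(a₁ * c) • (fy - L y)‖ ≤ m / 8 * ‖v‖ := by
    rw [norm_smul, Real.norm_eq_abs, abs_mul]
    calc |a₁| * |c| * ‖fy - L y‖ ≤ |a₁| * ‖v‖ * (ε * ‖y‖) := by gcongr
      _ = |‖y‖ * a₁| * ε * ‖v‖ := by rw [abs_mul, abs_norm]; ring
      _ ≤ 1 * ε * ‖v‖ := by gcongr
      _ ≤ m / 8 * ‖v‖ := by rw [one_mul]; gcongr
  have hsum : ((1 - c₂) • A' v + c₂ • L v) + (a₂ * c) • (L y - A' y) + c₁ • (K v - L v) +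
      (a₁ * c) • (fy - L y) = 0 := by
    rw [← hv]
    module
  exact linImm_eq_zero_of_sum_eq_zero hm (hS v) he₁ he₂ he₃ hsum

/-- **Differential of the interpolation** `z ↦ (1 - χ₂ ‖z‖) • A' z + χ₂ ‖z‖ • L z
+ χ₁ ‖z‖ • (f z - L z)` at a point `y ≠ 0` where `f` has differential `K` and `χᵢ` has
derivative `aᵢ` at `‖y‖` (product and chain rules, `d‖·‖(y) = ‖y‖⁻¹ ⟪y, ·⟫`). [folklore] -/
theorem linImm_hasFDerivAt (f : E4 → E4) (L A' : E4 →L[ℝ] E4) (χ₁ χ₂ : ℝ → ℝ) {y : E4}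
    (hy : y ≠ 0) {K : E4 →L[ℝ] E4} {a₁ a₂ : ℝ} (hf : HasFDerivAt f K y)
    (h₁ : HasDerivAt χ₁ a₁ ‖y‖) (h₂ : HasDerivAt χ₂ a₂ ‖y‖) :
    HasFDerivAt
      (fun z : E4 => (1 - χ₂ ‖z‖) • A' z + χ₂ ‖z‖ • L z + χ₁ ‖z‖ • (f z - L z))
      (((1 - χ₂ ‖y‖) • A' + (-(a₂ • (‖y‖⁻¹ • innerSL ℝ y))).smulRight (A' y)) +
        (χ₂ ‖y‖ • L + (a₂ • (‖y‖⁻¹ • innerSL ℝ y)).smulRight (L y)) +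
        (χ₁ ‖y‖ • (K - L) + (a₁ • (‖y‖⁻¹ • innerSL ℝ y)).smulRight (f y - L y))) y := by
  have hN := collarInterp_hasFDerivAt_norm hy
  have h1N : HasFDerivAt (fun z : E4 => χ₁ ‖z‖) (a₁ • (‖y‖⁻¹ • innerSL ℝ y)) y :=
    h₁.comp_hasFDerivAt y hN
  have h2N : HasFDerivAt (fun z : E4 => χ₂ ‖z‖) (a₂ • (‖y‖⁻¹ • innerSL ℝ y)) y :=
    h₂.comp_hasFDerivAt y hN
  have h2N' : HasFDerivAt (fun z : E4 => 1 - χ₂ ‖z‖) (-(a₂ • (‖y‖⁻¹ • innerSL ℝ y))) y :=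
    h2N.const_sub 1
  exact ((h2N'.smul A'.hasFDerivAt).add (h2N.smul L.hasFDerivAt)).add
    (h1N.smul (hf.sub L.hasFDerivAt))

/-- **First-order control of `f` near `0`.** If `f` is `C^∞` on the ball `‖y‖ < r₄` with
`f 0 = 0` and `df(0) = L`, then for every `ε > 0` there is `ρ ∈ (0, r₄]` with `‖df(y) - L‖ ≤ ε`
and `‖f y - L y‖ ≤ ε ‖y‖` for `‖y‖ < ρ` (continuity of `df` at `0`, then the mean value
inequality on the ball). [folklore] -/
theorem linImm_firstOrder (f : E4 → E4) (L : E4 →L[ℝ] E4) {r₄ ε : ℝ} (hr₄ : 0 < r₄)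
    (hε : 0 < ε) (hf : ∀ y : E4, ‖y‖ < r₄ → ContDiffAt ℝ ∞ f y) (hf0 : f 0 = 0)
    (hL : HasFDerivAt f L 0) :
    ∃ ρ : ℝ, 0 < ρ ∧ ρ ≤ r₄ ∧ ∀ y : E4, ‖y‖ < ρ →
      ‖fderiv ℝ f y - L‖ ≤ ε ∧ ‖f y - L y‖ ≤ ε * ‖y‖ := by
  have h0 : ContDiffAt ℝ ∞ f 0 := hf 0 (by rwa [norm_zero])
  have hc : ContinuousAt (fderiv ℝ f) 0 := h0.continuousAt_fderiv (by simp)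
  rw [Metric.continuousAt_iff] at hc
  obtain ⟨δ, hδ, hδε⟩ := hc ε hε
  have hρ0 : 0 < min δ r₄ := lt_min hδ hr₄
  have hD : ∀ z : E4, ‖z‖ < min δ r₄ → ‖fderiv ℝ f z - L‖ ≤ ε := by
    intro z hz
    have h := hδε (x := z) (by rw [dist_zero_right]; exact lt_of_lt_of_le hz (min_le_left _ _))
    rw [hL.fderiv, dist_eq_norm] at h
    exact h.le
  refine ⟨min δ r₄, hρ0, min_le_right _ _, fun y hy => ⟨hD y hy, ?_⟩⟩
  have hmv := (convex_ball (0 : E4) (min δ r₄)).norm_image_sub_le_of_norm_fderiv_le'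
    (𝕜 := ℝ) (f := f) (φ := L) (C := ε)
    (fun z hz => (hf z (lt_of_lt_of_le (mem_ball_zero_iff.mp hz) (min_le_right _ _)))
      |>.differentiableAt (by simp))
    (fun z hz => hD z (mem_ball_zero_iff.mp hz)) (Metric.mem_ball_self hρ0)
    (mem_ball_zero_iff.mpr hy)
  simpa [hf0] using hmv

/-- **Helper N2 (linearise-and-rotate a local diffeomorphism germ).** Given a smooth immersion
`f` of the ball `‖y‖ < r₄` in `ℝ⁴` with `f 0 = 0`, `df(0) = L`, and a linear isometry `A` for
which every `(1 - t)·id + t·(A ∘ L)`, `t ∈ [0, 1]`, is injective, there are radii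
`0 < r₁ < r₃ < r₄` and a map `g`, smooth with injective differential on `‖y‖ < r₄`, with
`g = A⁻¹` on `‖y‖ ≤ r₁` and `g = f` on `r₃ ≤ ‖y‖`.  The map is
`g y = (1 - χ₂ ‖y‖) • A⁻¹ y + χ₂ ‖y‖ • L y + χ₁ ‖y‖ • (f y - L y)` with two radial log-slow
cut-offs from `helper_slowStep`; see the module docstring for the estimates. [folklore] -/
theorem helper_linearizeImmersion2 :
    ∀ (f : E4 → E4) (L : E4 →L[ℝ] E4) (A : E4 ≃ₗᵢ[ℝ] E4) (r₄ : ℝ), 0 < r₄ →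
      (∀ y : E4, ‖y‖ < r₄ → ContDiffAt ℝ ∞ f y ∧ Injective (fderiv ℝ f y)) → f 0 = 0 →
      HasFDerivAt f L 0 →
      (∀ t : ℝ, 0 ≤ t → t ≤ 1 →
        Injective ((1 - t) • ContinuousLinearMap.id ℝ E4 +
          t • ((A.toContinuousLinearEquiv : E4 →L[ℝ] E4).comp L))) →
      ∃ (g : E4 → E4) (r₁ r₃ : ℝ), 0 < r₁ ∧ r₁ < r₃ ∧ r₃ < r₄ ∧
        (∀ y : E4, ‖y‖ < r₄ → ContDiffAt ℝ ∞ g y ∧ Injective (fderiv ℝ g y)) ∧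
        (∀ y : E4, ‖y‖ ≤ r₁ → g y = A.symm y) ∧
        (∀ y : E4, r₃ ≤ ‖y‖ → g y = f y) := by
  intro f L A r₄ hr₄ hf hf0 hL hseg
  -- the isometry `A⁻¹` as a continuous linear map
  obtain ⟨A', hA'⟩ : ∃ A' : E4 →L[ℝ] E4, ∀ v, A' v = A.symm v :=
    ⟨(A.symm.toContinuousLinearEquiv : E4 →L[ℝ] E4), fun _ => rfl⟩
  -- `S_t = (1 - t) A⁻¹ + t L = A⁻¹ ∘ T_t` has trivial kernel for `t ∈ [0, 1]`
  have hSinj : ∀ t : ℝ, 0 ≤ t → t ≤ 1 → ∀ v : E4, (1 - t) • A' v + t • L v = 0 → v = 0 := by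
    intro t ht0 ht1 v hv
    refine (injective_iff_map_eq_zero _).mp (hseg t ht0 ht1) v (A.symm.injective ?_)
    rw [LinearIsometryEquiv.map_zero, ← hv]
    simp only [add_apply, smul_apply, ContinuousLinearMap.id_apply,
      ContinuousLinearMap.coe_comp, Function.comp_apply, ContinuousLinearEquiv.coe_coe,
      LinearIsometryEquiv.coe_toContinuousLinearEquiv, map_add, map_smul,
      LinearIsometryEquiv.symm_apply_apply, hA']
  -- (1) the uniform lower bound `m` along the segment, the size `W` of `L - A⁻¹`, and `ε`
  obtain ⟨m, hm, hmS⟩ := linImm_uniform_lower_bound A' L hSinj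
  set W : ℝ := ‖L - A'‖ with hW
  have hW0 : 0 ≤ W := norm_nonneg _
  have hWy : ∀ y : E4, ‖L y - A' y‖ ≤ W * ‖y‖ := fun y => by
    rw [← sub_apply]
    exact ContinuousLinearMap.le_opNorm _ _
  -- (2) first-order control of `f` on `‖y‖ < ρ`
  obtain ⟨ρ, hρ0, hρ4, hρ⟩ :=
    linImm_firstOrder f L hr₄ (by positivity : 0 < m / 8) (fun y hy => (hf y hy).1) hf0 hL
  -- (3) the outer cut-off `χ₁` (`0` below `r₂`, `1` above `r₃ = ρ / 2`, `|r χ₁'| ≤ 1`)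
  obtain ⟨r₂, χ₁, hr₂0, hr₂3, hχ₁s, hχ₁0, hχ₁1, hχ₁01, -, hχ₁slow⟩ :=
    helper_slowStep (ρ / 2) 1 (by positivity) one_pos
  -- (4) the inner cut-off `χ₂` (`0` below `r₁`, `1` above `r₂`, `|r χ₂'| ≤ η₂`)
  have hW1 : 0 < W + 1 := by linarith
  obtain ⟨η₂, hη₂0, hη₂W⟩ : ∃ η₂ : ℝ, 0 < η₂ ∧ η₂ * W ≤ m / 4 := by
    refine ⟨m / (4 * (W + 1)), by positivity, ?_⟩
    calc m / (4 * (W + 1)) * W ≤ m / (4 * (W + 1)) * (W + 1) := by gcongr; linarith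
      _ = m / 4 := by field_simp
  obtain ⟨r₁, χ₂, hr₁0, hr₁2, hχ₂s, hχ₂0, hχ₂1, hχ₂01, -, hχ₂slow⟩ :=
    helper_slowStep r₂ η₂ hr₂0 hη₂0
  -- the interpolation
  obtain ⟨g, hg⟩ : ∃ g : E4 → E4,
      g = fun z => (1 - χ₂ ‖z‖) • A' z + χ₂ ‖z‖ • L z + χ₁ ‖z‖ • (f z - L z) := ⟨_, rfl⟩
  have hχ₁d : Differentiable ℝ χ₁ := hχ₁s.differentiable (by simp)
  have hχ₂d : Differentiable ℝ χ₂ := hχ₂s.differentiable (by simp)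
  refine ⟨g, r₁, ρ / 2, hr₁0, hr₁2.trans hr₂3, by linarith, ?_, ?_, ?_⟩
  · -- smooth immersion on the ball `‖y‖ < r₄`
    intro y hy
    rcases lt_or_ge ‖y‖ r₁ with h0 | h0
    · -- inner plateau: `g = A⁻¹` near `y`
      have hev : g =ᶠ[𝓝 y] ⇑A' := by
        filter_upwards [(isOpen_lt continuous_norm continuous_const).mem_nhds h0] with z hz
        have hz₂ : χ₂ ‖z‖ = 0 := hχ₂0 _ hz.le
        have hz₁ : χ₁ ‖z‖ = 0 := hχ₁0 _ (by linarith)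
        simp only [hg, hz₁, hz₂, sub_zero, one_smul, zero_smul, add_zero]
      refine ⟨A'.contDiff.contDiffAt.congr_of_eventuallyEq hev, ?_⟩
      rw [hev.fderiv_eq, A'.fderiv]
      intro u w h
      exact A.symm.injective (by rwa [← hA', ← hA'])
    rcases le_or_gt ‖y‖ (ρ / 2) with h3 | h3
    · -- transition zone `r₁ ≤ ‖y‖ ≤ ρ / 2`
      have hr0 : 0 < ‖y‖ := hr₁0.trans_le h0
      have hy0 : y ≠ 0 := norm_pos_iff.mp hr0
      obtain ⟨hK, hfy⟩ := hρ y (by linarith)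
      have hfs : ContDiffAt ℝ ∞ f y := (hf y hy).1
      have hfD : HasFDerivAt f (fderiv ℝ f y) y := (hfs.differentiableAt (by simp)).hasFDerivAt
      have hD := linImm_hasFDerivAt f L A' χ₁ χ₂ hy0 hfD (hχ₁d _).hasDerivAt (hχ₂d _).hasDerivAt
      have hn : ContDiffAt ℝ ∞ (fun z : E4 => ‖z‖) y := contDiffAt_norm ℝ hy0
      have h1c : ContDiffAt ℝ ∞ (fun z : E4 => χ₁ ‖z‖) y := hχ₁s.contDiffAt.comp y hn
      have h2c : ContDiffAt ℝ ∞ (fun z : E4 => χ₂ ‖z‖) y := hχ₂s.contDiffAt.comp y hn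
      refine ⟨?_, ?_⟩
      · rw [hg]
        exact (((contDiffAt_const.sub h2c).smul A'.contDiff.contDiffAt).add
          (h2c.smul L.contDiff.contDiffAt)).add (h1c.smul (hfs.sub L.contDiff.contDiffAt))
      · rw [hg, hD.fderiv]
        exact linImm_injective_fderiv hy0 hm (hmS _ (hχ₂01 _).1 (hχ₂01 _).2) (hWy y) hK hfy
          (hχ₁01 _).1 (hχ₁01 _).2 (hχ₁slow _) (hχ₂slow _) hη₂W le_rfl
    · -- outer region: `g = f` near `y`
      have hev : g =ᶠ[𝓝 y] f := by
        filter_upwards [(isOpen_lt continuous_const continuous_norm).mem_nhds h3] with z hz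
        have hz₁ : χ₁ ‖z‖ = 1 := hχ₁1 _ hz.le
        have hz₂ : χ₂ ‖z‖ = 1 := hχ₂1 _ (by linarith)
        simp only [hg, hz₁, hz₂, sub_self, zero_smul, zero_add, one_smul, add_sub_cancel]
      refine ⟨(hf y hy).1.congr_of_eventuallyEq hev, ?_⟩
      rw [hev.fderiv_eq]
      exact (hf y hy).2
  · -- `g = A⁻¹` on `‖y‖ ≤ r₁`
    intro y hy
    have h₂ : χ₂ ‖y‖ = 0 := hχ₂0 _ hy
    have h₁ : χ₁ ‖y‖ = 0 := hχ₁0 _ (by linarith)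
    simp only [hg, h₁, h₂, sub_zero, one_smul, zero_smul, add_zero, hA']
  · -- `g = f` on `ρ / 2 ≤ ‖y‖`
    intro y hy
    have h₁ : χ₁ ‖y‖ = 1 := hχ₁1 _ hy
    have h₂ : χ₂ ‖y‖ = 1 := hχ₂1 _ (by linarith)
    simp only [hg, h₁, h₂, sub_self, zero_smul, zero_add, one_smul, add_sub_cancel]

end Summit.SmoothPoincare4.SmoothPoincare4.Theorems.Target.KaehlerJacket

end
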